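import Summits.QuantumAdvantage.QuantumAdvantage.Theorems.MobiusLadderLiouvilleNotPPolyOneTimePadDefs
import Literature.Computability.Complexity.CircuitAdderMultiplier
import Literature.Computability.Complexity.CircuitClassesProofs
import HarnessLib

/-!
# Crux `MobiusLadder.LiouvilleNotPPoly` (stmt-QuantumAdvantage-1389), line `SketchIdeator4`, stub `stub_mulConstCircuit` (T2a)

One factor of a product-reading circuit. A `B₂`-circuit `C` on `k·n` input bits reads the low
`k·n` binary digits of a product; fixing all factors but one (their product is the constant `M`)
turns it into the test `y ↦ C(bits (k n) (ofBits y · M))` on ONE `n`-bit factor `y`. This file proves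
the size bound the XOR/hard-core argument of the line needs: that test is again a small
`B₂`-circuit, of size `≤ s + (k n (148 k n + 1) + 3)` when `C` has size `≤ s`.

Proof. Take the tree's schoolbook multiplier `ArithCkt.cktSize_mulBits (k n)` (two `k n`-bit
blocks in, the `2 k n` digits of their product out, `k n (148 k n + 1) + 1` gates), keep its low
`k n` output digits (`CktSize.outMap`, free) and feed them to `C` (`Circuit.cktSize_eval`,
`CktSize.comp`: sizes add). Then rewire the inputs (`CktSize.rewire`, free): the first block reads
`y` padded by the constant `false` to `k n` bits (so its value is `ofBits y`, as `n ≤ k n`), the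
second block reads the constant digits `testBit M j`, `j < k n` (value `M mod 2^{kn}`); the two
constants are hardwired at the cost of two constant gates (`CktSize.hardwire`). The low `k n` digits
of `ofBits y · (M mod 2^{kn})` are those of `ofBits y · M` (`Nat.mul_mod`, `Nat.testBit_mod_two_pow`).

Sources: H. Vollmer, *Introduction to Circuit Complexity* (1999), §1.2 (composition, projections,
constants), §1.3.2, Thm. 1.23 (school multiplication) — all through the tree's `CktSize` calculus.
-/

set_option linter.dupNamespace false -- D-0017: single-problem summit ⇒ `QuantumAdvantage.QuantumAdvantage` by design

noncomputable section

namespace Summit.QuantumAdvantage.QuantumAdvantage.Theorems.LiouvilleNotPPoly.OneTimePad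

open Literature.Computability.Complexity
open _root_.Computability Filter Finset Polynomial
open Summit.QuantumAdvantage.QuantumAdvantage.Theorems.LiouvilleOrthogonalTC0 (bits ofBits lamBit)

namespace MulConstCircuit

open ArithCkt

/-- The padded first block of the multiplier's inputs — wire `i` reads the input `y_i` for `i < n`
and the hardwired constant `false` otherwise (the constants live on the `Bool` summand, hardwired by
`ω := id`) — reads back as the number `ofBits y` (for `n ≤ m`). -/
theorem ofBits_pad {n m : ℕ} (hnm : n ≤ m) (y : Fin n → Bool) :
    Nat.ofBits (fun i : Fin m =>
        Sum.elim y id (if h : (i : ℕ) < n then Sum.inl ⟨i, h⟩ else Sum.inr false)) = ofBits y := by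
  have hy : Nat.ofBits y = ofBits y :=
    Literature.Computability.AlgebraicComplexity.BoolGadgets.ofBits_eq_sum y
  rw [← hy]
  apply Nat.eq_of_testBit_eq
  intro t
  by_cases ht : t < n
  · have htm : t < m := ht.trans_le hnm
    simp [ht, htm]
  · by_cases htm : t < m
    · simp [Nat.testBit_ofBits, ht, htm]
    · simp [Nat.testBit_ofBits, ht, htm]

/-- The low `m` digits of a product depend on the second factor only modulo `2^m`. -/
theorem testBit_mul_mod_two_pow {a M m l : ℕ} (hl : l < m) :
    (a * (M % 2 ^ m)).testBit l = (a * M).testBit l := by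
  have h1 : ∀ u : ℕ, u.testBit l = (u % 2 ^ m).testBit l := fun u => by
    rw [Nat.testBit_mod_two_pow, decide_eq_true hl, Bool.true_and]
  rw [h1, h1 (a * M), Nat.mul_mod, Nat.mod_mod, ← Nat.mul_mod]

/-- On the rewired-and-hardwired inputs (first block: `y` padded by `false`; second block: the
constant digits `testBit M j`, value `M mod 2^m`) the multiplier's low output digit `l < m` is
digit `l` of `ofBits y · M`. -/
theorem mulBits_pad_const {n m : ℕ} (hnm : n ≤ m) (M : ℕ) (y : Fin n → Bool) (l : Fin m) :
    mulBits m (fun v => Sum.elim y id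
        (Sum.elim (fun i : Fin m => if h : (i : ℕ) < n then Sum.inl ⟨i, h⟩ else Sum.inr false)
          (fun j : Fin m => Sum.inr (Nat.testBit M j)) v)) (Fin.castAdd m l) =
      bits m (ofBits y * M) l := by
  change (Nat.ofBits (fun i : Fin m =>
        Sum.elim y id (if h : (i : ℕ) < n then Sum.inl ⟨i, h⟩ else Sum.inr false)) *
      Nat.ofBits (fun j : Fin m => Nat.testBit M j)).testBit l = (ofBits y * M).testBit l
  rw [ofBits_pad hnm, Nat.ofBits_testBit]
  exact testBit_mul_mod_two_pow l.isLt

/-- The gate budget of one shift-and-add round of the `m`-bit schoolbook multiplier is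
`148 m + 1`. -/
theorem mulStepSize_eq (m : ℕ) : mulStepSize m = 148 * m + 1 := by
  simp only [mulStepSize, addSize]
  omega

end MulConstCircuit

open MulConstCircuit ArithCkt

/-- **T2a · `stub_mulConstCircuit` — one factor of a product-reading circuit.** For a
`B₂`-circuit `C` on `k·n` inputs of size `≤ s` and a constant `M`, the map
`y ↦ C(low k·n digits of (ofBits y)·M)` on `n` input bits has a `B₂`-circuit of size
`≤ s + (k n (148 k n + 1) + 3)`: pad `y` to `k n` bits, hardwire the `k n` low digits of `M` (two
constant gates, `CktSize.hardwire`), multiply with the schoolbook multiplier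
`ArithCkt.cktSize_mulBits (k n)` (size `k n (148 k n + 1) + 1`), keep the low `k n` output digits
(`(ofBits y · M) mod 2^{kn}` depends on `M mod 2^{kn}` only) and feed `C` (`Circuit.cktSize_eval`,
`CktSize.comp`). -/
theorem stub_mulConstCircuit :
    ∀ n k s M : ℕ, 1 ≤ k → ∀ C : Circuit (Fin (k * n)), C.IsOver B2 → C.size ≤ s →
      CktSize B2 (fun (y : Fin n → Bool) (_ : Unit) => C.eval (bits (k * n) (ofBits y * M)))
        (s + (k * n * (148 * (k * n) + 1) + 3)) := by
  intro n k s M hk C hC hs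
  have hnm : n ≤ k * n := Nat.le_mul_of_pos_left n hk
  -- stage 1: the low `k n` digits of the product of the two `k n`-bit input blocks
  have hmul : CktSize B2 (fun (x : Fin (k * n) ⊕ Fin (k * n) → Bool) (l : Fin (k * n)) =>
      mulBits (k * n) x (Fin.castAdd (k * n) l)) (k * n * mulStepSize (k * n) + 1) :=
    (cktSize_mulBits (k * n)).outMap (Fin.castAdd (k * n))
  -- stage 2: feed `C`; stage 3: rewire the inputs to `y ⊕ constants` and hardwire the constants
  have hhw := ((hmul.comp (C.cktSize_eval hC)).rewire (ι' := Fin n ⊕ Bool)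
    (Sum.elim (fun i : Fin (k * n) => if h : (i : ℕ) < n then Sum.inl ⟨i, h⟩ else Sum.inr false)
      (fun j : Fin (k * n) => Sum.inr (Nat.testBit M j)))).hardwire id
  refine (hhw.of_le ?_).congr fun y _ => ?_
  · rw [mulStepSize_eq]
    omega
  · exact congrArg C.eval (funext fun l => mulBits_pad_const hnm M y l)

end Summit.QuantumAdvantage.QuantumAdvantage.Theorems.LiouvilleNotPPoly.OneTimePad

end
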